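import Summits.RiemannHypothesis.RiemannHypothesis.Theses.SpectralTrace
import Literature.NumberTheory.LFunctions.WeilArchimedeanPositivityProofs
import Literature.NumberTheory.LFunctions.WeilArchimedeanMoments
import Literature.NumberTheory.LFunctions.WeilSmallSupportPositivity
import Literature.NumberTheory.LFunctions.WeilGroundState
import HarnessLib

/-!
# `WindowTraceArch` — negative lemma: no finite spectrum on any window

Support lemmas for the crux `stmt-RiemannHypothesis-11195`
(`Summit.RiemannHypothesis.RiemannHypothesis.Theses.SpectralTrace.WindowTraceArch`), recorded by
the standing disprover (`Cruxes/WindowTraceArch/Disproof.lean` §2).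

* `infinite_of_windowTrace` : if a real family `γ : ι → ℝ` reproduces the Weil functional,
  `HasSum (i ↦ ĝ(1/2 + iγ_i)) (W g)`, on every Weil test `g` supported in `[-A, A]` for some
  `A > 0`, then `ι` is infinite. Proof: for `g` on the unit `L²` sphere with support in `[-a, a]`,
  `2a ≤ A`, the test `k = g ⋆ g̃` lies in the window and `k̂(1/2+iγ) = |ĝ(1/2+iγ)|²`
  (`weilMellin_weilConv_weilReflect_half`), so `Q(g) = Σ_i |ĝ(1/2+iγ_i)|² ≤ #ι · ‖g‖₁² ≤ #ι · 2a`
  (`norm_weilMellin_half_line_le`, `weilNorm1_sq_le`), contradicting Bombieri's coercivity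
  `Q(g) ≥ (#ι + 1) ‖g‖₂²` for small `a` (`weilQuadratic_coercive`, `exists_isWeilTest_sphere`).
* `not_windowTrace_finite`, `not_windowTraceArch_finite` : the natural small-model
  strengthening "a FINITE real spectrum reproduces `W` on the window" is false.
* `windowTrace_of_nonpos` : tightness of `0 < A` — for `A ≤ 0` the empty family is a witness.
-/

noncomputable section

open Complex Set MeasureTheory

namespace Summit.RiemannHypothesis.RiemannHypothesis.Theorems.WindowTraceArch.Negative

open Literature.NumberTheory.LFunctions

/-- **Every window-trace family is infinite.** If `HasSum (i ↦ ĝ(1/2 + iγ_i)) (W g)` for every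
Weil test `g` supported in `[-A, A]`, `A > 0`, then the index type is infinite (Bombieri's
coercivity of `Q` for thin support against the bound `|ĝ(1/2+iγ)|² ≤ 2a ‖g‖₂²`). [folklore] -/
theorem infinite_of_windowTrace {A : ℝ} (hA : 0 < A) {ι : Type*} {γ : ι → ℝ}
    (h : ∀ g : ℝ → ℂ, IsWeilTest g → tsupport g ⊆ Icc (-A) A →
      HasSum (fun i => weilMellin g (1 / 2 + (γ i : ℂ) * I)) (weilFunctional g)) :
    Infinite ι := by
  by_contra hfin
  rw [not_infinite_iff_finite] at hfin
  cases nonempty_fintype ι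
  set n : ℕ := Fintype.card ι with hn
  obtain ⟨a₀, ha₀, hco⟩ := weilQuadratic_coercive ((n : ℝ) + 1)
  set a : ℝ := min a₀ (min (1 / 2) (A / 2)) with ha_def
  have ha : 0 < a := lt_min ha₀ (lt_min one_half_pos (half_pos hA))
  have haa₀ : a ≤ a₀ := min_le_left _ _
  have ha2 : a ≤ 1 / 2 := (min_le_right _ _).trans (min_le_left _ _)
  have haA : a ≤ A / 2 := (min_le_right _ _).trans (min_le_right _ _)
  obtain ⟨g, hg, hgs, hnorm⟩ := exists_isWeilTest_sphere ha
  -- coercivity on the unit sphere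
  have hlow : ((n : ℝ) + 1) * ∫ t, ‖g t‖ ^ 2 ≤ (weilQuadratic g).re := hco a ha haa₀ g hg hgs
  rw [hnorm, mul_one] at hlow
  -- the trace identity for `k = g ⋆ g̃`
  have hk : IsWeilTest (weilConv g (weilReflect g)) := hg.weilConv hg.weilReflect
  have hks : tsupport (weilConv g (weilReflect g)) ⊆ Icc (-A) A :=
    (tsupport_weilConv_weilReflect_subset hg.2 hgs).trans
      (Icc_subset_Icc (by linarith) (by linarith))
  have hsum := h _ hk hks
  have hsum' : HasSum (fun i => (((‖weilMellin g (1 / 2 + (γ i : ℂ) * I)‖ ^ 2 : ℝ) : ℂ)))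
      (weilFunctional (weilConv g (weilReflect g))) := by
    simpa only [weilMellin_weilConv_weilReflect_half hg] using hsum
  have hQ : weilFunctional (weilConv g (weilReflect g)) =
      ∑ i, (((‖weilMellin g (1 / 2 + (γ i : ℂ) * I)‖ ^ 2 : ℝ) : ℂ)) :=
    hsum'.unique (hasSum_fintype _)
  -- each term is at most `2a ≤ 1`
  have h1 : weilNorm1 g ^ 2 ≤ 2 * a * weilNorm2Sq g := weilNorm1_sq_le hg ha hgs
  have h2 : weilNorm2Sq g = 1 := hnorm
  have hterm : ∀ i, ‖weilMellin g (1 / 2 + (γ i : ℂ) * I)‖ ^ 2 ≤ 1 := by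
    intro i
    have h3 := norm_weilMellin_half_line_le hg (γ i)
    have h4 : ‖weilMellin g (1 / 2 + (γ i : ℂ) * I)‖ ^ 2 ≤ weilNorm1 g ^ 2 :=
      pow_le_pow_left₀ (norm_nonneg _) h3 2
    nlinarith
  have hup : (weilQuadratic g).re ≤ n := by
    unfold weilQuadratic
    rw [hQ, Complex.re_sum]
    simp only [Complex.ofReal_re]
    calc ∑ i, ‖weilMellin g (1 / 2 + (γ i : ℂ) * I)‖ ^ 2 ≤ ∑ _i : ι, (1 : ℝ) :=
          Finset.sum_le_sum fun i _ => hterm i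
      _ = n := by simp [hn]
  linarith

/-- **No finite real spectrum reproduces `W` on any window `A > 0`.** [folklore] -/
theorem not_windowTrace_finite {A : ℝ} (hA : 0 < A) :
    ¬ ∃ (ι : Type) (_ : Finite ι) (γ : ι → ℝ), ∀ g : ℝ → ℂ, IsWeilTest g →
      tsupport g ⊆ Icc (-A) A →
        HasSum (fun i => weilMellin g (1 / 2 + (γ i : ℂ) * I)) (weilFunctional g) := by
  rintro ⟨ι, hι, γ, h⟩
  exact (infinite_of_windowTrace hA h).not_finite hι

/-- In particular on the archimedean window `[-log 2, log 2]` of the crux `WindowTraceArch`: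
its finite-spectrum strengthening is false. [folklore] -/
theorem not_windowTraceArch_finite :
    ¬ ∃ (ι : Type) (_ : Finite ι) (γ : ι → ℝ), ∀ g : ℝ → ℂ, IsWeilTest g →
      tsupport g ⊆ Icc (-Real.log 2) (Real.log 2) →
        HasSum (fun i => weilMellin g (1 / 2 + (γ i : ℂ) * I)) (weilFunctional g) :=
  not_windowTrace_finite (Real.log_pos one_lt_two)

/-- Any witness family of the crux `WindowTraceArch` is infinite. [folklore] -/
theorem infinite_of_windowTraceArch_witness {ι : Type} {γ : ι → ℝ}
    (h : ∀ g : ℝ → ℂ, IsWeilTest g → tsupport g ⊆ Icc (-Real.log 2) (Real.log 2) →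
      HasSum (fun i => weilMellin g (1 / 2 + (γ i : ℂ) * I)) (weilFunctional g)) :
    Infinite ι :=
  infinite_of_windowTrace (Real.log_pos one_lt_two) h

/-- `W(0) = 0`. [folklore] -/
theorem weilFunctional_zero : weilFunctional (0 : ℝ → ℂ) = 0 := by
  simp [weilFunctional, weilPolarTerm, weilPrimeTerm, weilArchTerm, weilArchIntegral, weilMellin]

/-- **Tightness of `0 < A`.** For `A ≤ 0` the window carries only `g = 0` (the support of a
continuous `g` is open and sits inside `(-A, A) = ∅`), and the EMPTY family is a witness of the
window trace. [folklore] -/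
theorem windowTrace_of_nonpos {A : ℝ} (hA : A ≤ 0) :
    ∃ (ι : Type) (γ : ι → ℝ), ∀ g : ℝ → ℂ, IsWeilTest g → tsupport g ⊆ Icc (-A) A →
      HasSum (fun i => weilMellin g (1 / 2 + (γ i : ℂ) * I)) (weilFunctional g) := by
  refine ⟨PEmpty, fun i => i.elim, fun g hg hgs => ?_⟩
  have hsupp := support_subset_Ioo_of_tsupport_subset_Icc hg.1.continuous hgs
  rw [Set.Ioo_eq_empty (by linarith : ¬ (-A < A)), Set.subset_empty_iff,
    Function.support_eq_empty_iff] at hsupp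
  rw [hsupp, weilFunctional_zero]
  exact hasSum_empty

end Summit.RiemannHypothesis.RiemannHypothesis.Theorems.WindowTraceArch.Negative

end
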